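import Mathlib
import Literature.Probability.RandomPlanarGeometry.HexSAW
import Literature.Probability.LatticeModels.AnchoredClusterExpansion
import Literature.Probability.LatticeModels.PolymerPressureAnalytic
import Literature.Probability.LatticeModels.PolymerGasGeometric
import Summits.CriticalPhenomena.SAWScalingLimit.Theses.SAWMassiveIsingTilt
import Summits.CriticalPhenomena.SAWScalingLimit.Theorems.SAWMassiveIsingTiltDefs
import Summits.CriticalPhenomena.SAWScalingLimit.Theorems.SAWMassiveIsingTiltTiltLawBasic
import Summits.CriticalPhenomena.SAWScalingLimit.Theorems.SAWMassiveIsingTiltCriticalCurveContinuityDifferentiableZloop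
import Summits.CriticalPhenomena.SAWScalingLimit.Theorems.SAWMassiveIsingTiltCriticalCurveContinuityZloopPolymerGas
import Summits.CriticalPhenomena.SAWScalingLimit.Theorems.SAWMassiveIsingTiltCriticalCurveContinuityIsSmallActivityLoopActivity
import Summits.CriticalPhenomena.SAWScalingLimit.Theorems.SAWMassiveIsingTiltCriticalCurveContinuityRestrictionSmallFugacity
import Summits.CriticalPhenomena.SAWScalingLimit.Theorems.SAWMassiveIsingTiltCriticalCurveContinuityScoreBoundSmallFugacity

/-!
# Score quasi-locality in the Kotecký–Preiss regime (route `SAWMassiveIsingTilt`)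

Route `SAWMassiveIsingTilt` of `CriticalPhenomena/SAWScalingLimit`; line `registered` of the crux
`CriticalCurveContinuity` (stmt-CriticalPhenomena-7686), cycle 4, sub-goal S1
`zloop_scoreDefect_le_smallFugacity`: the `y`-DERIVATIVE of the four-term restriction defect of
`zloop_restrictionDefect_le_smallFugacity`.

**Statement.** There are `y₁ > 0`, `C` and `c > 0` such that for every `y ∈ [0, y₁]`, every
Dobrushin domain `D`, mesh `δ > 0`, vertex set `S ⊆ V := vertices of Ω_δ` and hexagonal SAW `γ` of
`Ω_δ` (vertex set `T`),
`|(∂_y log Zloop(Ω_δ∖γ) − ∂_y log Zloop(Ω_δ)) − (∂_y log Zloop(S∖T) − ∂_y log Zloop(S))|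
   ≤ C Σ_{v ∈ γ} Σ_{w ∈ V∖S} exp(−c·d_Hex(v, w))`
(`y₁ = y₀/4`, `C = 2/y₀`, `c = ½`, `y₀` the smallness radius of `isSmallActivity_loopActivity`):
the walk-dependent part of the bath score computed in a sub-domain `S ⊇ γ` differs from the
full-domain one by exponentially small boundary terms.

**Proof.** Merge of the two landed templates. With `zloop_eq_polymerPartitionFunction` the four
partition functions are subset-polymer partition functions on the volumes `𝒫(W)`, `𝒫(W) ∖ D_γ`,
`𝒫(T_S)`, `𝒫(T_S) ∖ D_γ` (`D_γ` = polymers meeting `γ`). For complex `z` put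
`g(z) := [log Ξ(𝒫(W)) − log Ξ(𝒫(W)∖D_γ)] − [log Ξ(𝒫(T_S)) − log Ξ(𝒫(T_S)∖D_γ)]` (Kotecký–Preiss
logarithms); by the unconditional KP (2) (`polymerLogZ_sub_sdiff_eq_sum`) each bracket is the sum
of the truncated functionals of the clusters meeting `D_γ`, so `g(z)` is the sum over the clusters
inside `𝒫(W)` meeting `D_γ` and not inside `𝒫(T_S)`; every such cluster passes through some
`v ∈ γ` and some `w ∈ V ∖ S`, whence (`sum_filter_meets_le_sum_sum`,
`sum_norm_truncatedWeight_through_le`, smallness `isSmallActivity_loopActivity` for `‖z‖ ≤ y₀`)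
`‖g(z)‖ ≤ B := Σ_{v∈γ} Σ_{w∈V∖S} e^{−½ d(v,w)}`. `g` is holomorphic on `|z| < y₀`
(`differentiableOn_polymerLogZ_param`), so the Cauchy estimate on the circle of radius `y₀/2`
about `y ∈ [0, y₀/4]` gives `|g'(y)| ≤ 2B/y₀`; on the real axis `g` is the real four-term
log-combination (`polymerLogZ_eq_log_of_real`), whose derivative is the four-term combination of
logarithmic derivatives of `Zloop` (`differentiable_zloop`, `one_le_zloop`).
-/

noncomputable section

open Finset Filter Topology Metric
open Literature.Probability Literature.Probability.LatticeModels
  Literature.Probability.RandomPlanarGeometry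
open Summit.CriticalPhenomena.SAWScalingLimit.Theses.SAWMassiveIsingTilt
open Summit.CriticalPhenomena.SAWScalingLimit.Theorems.ObservableToSLE.Negative
  (finite_embMeshVertices_hex)
open scoped Classical

namespace Summit.CriticalPhenomena.SAWScalingLimit.Theorems.SAWMassiveIsingTilt

/-! ### Volume bookkeeping -/

/-- The polymers of `T_{X ∖ γ}` are the polymers of `T_X` not meeting the walk `γ`, the deleted
family being taken inside the whole volume `𝒫(W)` (implicit decidability instances, so that the
lemma rewrites terms carrying arbitrary instances). -/
theorem powerset_filter_mem_sdiff_walk (W : Finset HexVertex) (X : Set HexVertex)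
    (L : List HexVertex)
    {_i₁ : DecidablePred fun v : HexVertex => v ∈ X \ {u : HexVertex | u ∈ L}}
    {_i₂ : DecidablePred fun v : HexVertex => v ∈ X}
    {_i₃ : DecidablePred fun A : Finset HexVertex => ∃ v ∈ A, v ∈ L} :
    (W.filter fun v => v ∈ X \ {u : HexVertex | u ∈ L}).powerset =
      (W.filter fun v => v ∈ X).powerset \ W.powerset.filter fun A => ∃ v ∈ A, v ∈ L := by
  ext A
  simp only [Finset.mem_powerset, Finset.mem_sdiff, Finset.mem_filter, Finset.subset_iff,
    Set.mem_sdiff, Set.mem_setOf_eq, not_and, not_exists]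
  constructor
  · intro h
    exact ⟨fun a ha => ⟨(h ha).1, (h ha).2.1⟩, fun _ a ha hL => (h ha).2.2 hL⟩
  · rintro ⟨h1, h2⟩ a ha
    exact ⟨(h1 ha).1, (h1 ha).2, h2 (fun b hb => (h1 hb).1) a ha⟩

/-- Every endpoint of an edge of `Ω_δ` is a vertex of the discrete domain `Ω_δ`. -/
theorem mem_embMeshDomain_of_mem_biUnion_edgeSet {Ω : Set ℂ} (hΩ : Bornology.IsBounded Ω) {δ : ℝ}
    (hδ : δ ≠ 0) {w : HexVertex}
    (hw : w ∈ (finite_edgeSet_hexDomainGraph hΩ hδ).toFinset.biUnion Sym2.toFinset) :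
    w ∈ SAW.embMeshDomain hexGraph hexCenter Ω δ := by
  obtain ⟨e, he, hwe⟩ := Finset.mem_biUnion.1 hw
  rw [Set.Finite.mem_toFinset] at he
  induction e using Sym2.ind with
  | h u u' =>
    rw [SimpleGraph.mem_edgeSet] at he
    have h := (SAW.embDomainGraph_adj_iff hexGraph hexCenter).1 he
    rw [Sym2.mem_toFinset, Sym2.mem_iff] at hwe
    rcases hwe with rfl | rfl
    exacts [h.2.1, h.2.2]

/-! ### The theorem -/

/-- **Sub-goal S1 of the line (cycle 4): SCORE QUASI-LOCALITY IN THE KOTECKÝ–PREISS REGIME.**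
There are `y₁ > 0`, `C` and `c > 0` such that for every `y ∈ [0, y₁]`, every Dobrushin domain, mesh
`δ > 0`, `S ⊆ V = vertices of Ω_δ` and hexagonal SAW `γ` with vertex set `T`,
`|(∂_y log Zloop(Ω_δ∖γ) − ∂_y log Zloop(Ω_δ)) − (∂_y log Zloop(S∖T) − ∂_y log Zloop(S))|
  ≤ C Σ_{v ∈ γ} Σ_{w ∈ V∖S} e^{−c d_Hex(v,w)}` — the `y`-derivative of the restriction defect. -/
theorem zloop_scoreDefect_le_smallFugacity : ∃ y₁ : ℝ, 0 < y₁ ∧ ∃ C c : ℝ, 0 < c ∧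
    ∀ y ∈ Set.Icc (0 : ℝ) y₁, ∀ (D : DobrushinDomain) (δ : ℝ), 0 < δ →
      ∀ (S : Set HexVertex) (a b : HexVertex) (γ : SAW.HexDomainSAW D.carrier δ a b),
        (∀ v ∈ γ.walk.support, v ∈ S) → S ⊆ SAW.embMeshDomain hexGraph hexCenter D.carrier δ →
          |(deriv (fun t => Zloop (SAW.hexDomainGraph D.carrier δ) {v | v ∉ γ.walk.support} t) y /
                Zloop (SAW.hexDomainGraph D.carrier δ) {v | v ∉ γ.walk.support} y -
              deriv (fun t => Zloop (SAW.hexDomainGraph D.carrier δ) Set.univ t) y /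
                Zloop (SAW.hexDomainGraph D.carrier δ) Set.univ y) -
            (deriv (fun t => Zloop (SAW.hexDomainGraph D.carrier δ) (S \ {v | v ∈ γ.walk.support}) t) y /
                Zloop (SAW.hexDomainGraph D.carrier δ) (S \ {v | v ∈ γ.walk.support}) y -
              deriv (fun t => Zloop (SAW.hexDomainGraph D.carrier δ) S t) y /
                Zloop (SAW.hexDomainGraph D.carrier δ) S y)| ≤
            C * ∑ v ∈ γ.walk.support.toFinset,
              ∑ᶠ w ∈ SAW.embMeshDomain hexGraph hexCenter D.carrier δ \ S,
                Real.exp (-(c * (hexGraph.dist v w : ℝ))) := by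
  obtain ⟨y₀, hy₀, hsmallAll⟩ := isSmallActivity_loopActivity
  refine ⟨y₀ / 4, by positivity, 2 / y₀, 1 / 2, one_half_pos, fun y hy D δ hδ S a b γ _ hSV => ?_⟩
  have hΩ : Bornology.IsBounded D.carrier := D.isBounded
  have hδ0 : δ ≠ 0 := ne_of_gt hδ
  -- notation
  set H := SAW.hexDomainGraph D.carrier δ with hH
  set V : Set HexVertex := SAW.embMeshDomain hexGraph hexCenter D.carrier δ with hV
  set Sγ : Set HexVertex := {v | v ∉ γ.walk.support} with hSγ
  set Tγ : Set HexVertex := {v | v ∈ γ.walk.support} with hTγ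
  set EH : Finset (Sym2 HexVertex) := (finite_edgeSet_hexDomainGraph hΩ hδ0).toFinset with hEH
  set W : Finset HexVertex := EH.biUnion Sym2.toFinset with hW
  set ρ : ℂ → Finset HexVertex → ℂ := fun z A => ∑ E ∈ EH.powerset with (E.biUnion Sym2.toFinset = A ∧
      A.Nonempty ∧ (∀ u : HexVertex, Even (E.filter (fun e => u ∈ e)).card) ∧
      ∀ u ∈ A, ∀ w ∈ A,
        (SimpleGraph.fromEdgeSet ((E : Finset (Sym2 HexVertex)) : Set (Sym2 HexVertex))).Reachable u w),
    z ^ E.card with hρ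
  obtain ⟨Dγ, hDγ⟩ : ∃ Dγ : Finset (Finset HexVertex),
      Dγ = W.powerset.filter fun A => ∃ v ∈ A, v ∈ γ.walk.support := ⟨_, rfl⟩
  have hTSW : (W.filter fun v => v ∈ S) ⊆ W := Finset.filter_subset _ _
  have hEHhex : ∀ e ∈ EH, e ∈ hexGraph.edgeSet := by
    intro e he
    rw [hEH, Set.Finite.mem_toFinset] at he
    exact SimpleGraph.edgeSet_mono (SAW.embDomainGraph_le hexGraph hexCenter D.carrier δ) he
  have hWV : ∀ w ∈ W, w ∈ V := fun w hw => mem_embMeshDomain_of_mem_biUnion_edgeSet hΩ hδ0 hw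
  -- smallness in the closed disc, also along rays
  have hsmall : ∀ z : ℂ, ‖z‖ ≤ y₀ → IsSmallActivity (ρ z) (1 / 2) := fun z hz => hsmallAll EH hEHhex z hz
  have hρ0 : ∀ z : ℂ, ρ z ∅ = 0 := fun z => by
    refine Finset.sum_eq_zero fun E hE => ?_
    exact absurd (Finset.mem_filter.1 hE).2.2.1 Finset.not_nonempty_empty
  have hray : ∀ z : ℂ, ‖z‖ ≤ y₀ → ∀ u ∈ Set.Icc (0 : ℝ) 1,
      IsSmallActivity (fun A => (u : ℂ) * ρ z A) (1 / 2) := by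
    intro z hz u hu
    refine isSmallActivity_of_norm_le (hsmall z hz) (by rw [hρ0 z, mul_zero]) fun A => ?_
    rw [norm_mul, Complex.norm_real, Real.norm_eq_abs, abs_of_nonneg hu.1]
    exact mul_le_of_le_one_left (norm_nonneg _) hu.2
  -- the complex four-term log-combination and its cluster representation
  set g : ℂ → ℂ := fun z =>
    (polymerLogZ polyInc (ρ z) W.powerset - polymerLogZ polyInc (ρ z) (W.powerset \ Dγ)) -
      (polymerLogZ polyInc (ρ z) (W.filter fun v => v ∈ S).powerset -
        polymerLogZ polyInc (ρ z) ((W.filter fun v => v ∈ S).powerset \ Dγ)) with hg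
  obtain ⟨𝒟, h𝒟⟩ : ∃ 𝒟 : Finset (Finset (Finset HexVertex)),
      𝒟 = (W.powerset.powerset.filter fun C => (C ∩ Dγ).Nonempty) \
        ((W.filter fun v => v ∈ S).powerset.powerset.filter fun C => (C ∩ Dγ).Nonempty) := ⟨_, rfl⟩
  have hsub : ((W.filter fun v => v ∈ S).powerset.powerset.filter fun C => (C ∩ Dγ).Nonempty) ⊆
      W.powerset.powerset.filter fun C => (C ∩ Dγ).Nonempty :=
    Finset.filter_subset_filter _ (Finset.powerset_mono.2 (Finset.powerset_mono.2 hTSW))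
  have h𝒟sub : 𝒟 ⊆ W.powerset.powerset := by
    rw [h𝒟]
    exact Finset.sdiff_subset.trans (Finset.filter_subset _ _)
  have hgsum : ∀ z, g z = ∑ C ∈ 𝒟, truncatedWeight polyInc (ρ z) C := by
    intro z
    simp only [hg]
    rw [polymerLogZ_sub_sdiff_eq_sum, polymerLogZ_sub_sdiff_eq_sum, h𝒟, Finset.sum_sdiff_eq_sub hsub]
  -- finiteness of `V ∖ S`
  have hVfin : (V \ S).Finite :=
    ((finite_embMeshVertices_hex hΩ hδ0).subset (SAW.embMeshDomain_subset hexGraph hexCenter _ _)).subset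
      Set.sdiff_subset
  -- every cluster of `𝒟` passes through some `v ∈ γ` and some `w ∈ V ∖ S`
  have hmeet : ∀ C ∈ 𝒟, ∃ v ∈ γ.walk.support.toFinset, ∃ w ∈ hVfin.toFinset,
      v ∈ clusterSupp C ∧ w ∈ clusterSupp C := by
    intro C hC
    rw [h𝒟] at hC
    simp only [Finset.mem_sdiff, Finset.mem_filter, Finset.mem_powerset, not_and] at hC
    obtain ⟨⟨hCW, A', hA'⟩, hCS⟩ := hC
    obtain ⟨hA'C, hA'D⟩ := Finset.mem_inter.1 hA'
    rw [hDγ] at hA'D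
    obtain ⟨-, v, hvA', hvT⟩ := Finset.mem_filter.1 hA'D
    have hCS' : ¬ C ⊆ (W.filter fun v => v ∈ S).powerset := fun h => hCS h ⟨A', hA'⟩
    obtain ⟨A, hAC, hATS⟩ := Finset.not_subset.1 hCS'
    obtain ⟨w, hwA, hwTS⟩ := Finset.not_subset.1 (fun h => hATS (Finset.mem_powerset.2 h))
    have hwW : w ∈ W := Finset.mem_powerset.1 (hCW hAC) hwA
    have hwS : w ∉ S := fun h => hwTS (Finset.mem_filter.2 ⟨hwW, h⟩)
    exact ⟨v, List.mem_toFinset.2 hvT, w, hVfin.mem_toFinset.2 ⟨hWV w hwW, hwS⟩,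
      mem_clusterSupp.2 ⟨A', hA'C, hvA'⟩, mem_clusterSupp.2 ⟨A, hAC, hwA⟩⟩
  -- the bound on `g` in the closed disc
  set B : ℝ := ∑ v ∈ γ.walk.support.toFinset, ∑ w ∈ hVfin.toFinset,
      Real.exp (-((1 / 2) * (hexGraph.dist v w : ℝ))) with hB
  have hgbound : ∀ z : ℂ, ‖z‖ ≤ y₀ → ‖g z‖ ≤ B := by
    intro z hz
    have hconn : ∀ A, ρ z A ≠ 0 → IsRConnected hexGraph.Adj A :=
      fun A hA => isRConnected_of_loopActivity_ne_zero hEHhex z A hA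
    rw [hgsum z]
    refine (norm_sum_le _ _).trans ?_
    refine (sum_filter_meets_le_sum_sum h𝒟sub _ _ _ (fun _ => norm_nonneg _) hmeet).trans ?_
    exact Finset.sum_le_sum fun v _ => Finset.sum_le_sum fun w _ =>
      sum_norm_truncatedWeight_through_le (hsmall z hz) hconn _ v w
  -- holomorphy of `g` on the open disc
  have hρdiff : ∀ A, Differentiable ℂ fun z => ρ z A := by
    intro A
    simp only [hρ]
    exact Differentiable.fun_sum fun E _ => differentiable_pow E.card
  have hZne : ∀ (B' : Finset (Finset HexVertex)), ∀ z ∈ ball (0 : ℂ) y₀, ∀ u ∈ Set.Icc (0 : ℝ) 1,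
      polymerPartitionFunction polyInc (fun A => (u : ℂ) * ρ z A) B' ≠ 0 := by
    intro B' z hz u hu
    exact (hray z (le_of_lt (mem_ball_zero_iff.1 hz)) u hu).polymerPartitionFunction_ne_zero B'
  have hLdiff : ∀ B' : Finset (Finset HexVertex),
      DifferentiableOn ℂ (fun z => polymerLogZ polyInc (ρ z) B') (ball (0 : ℂ) y₀) := fun B' =>
    differentiableOn_polymerLogZ_param (inc := polyInc) B' isOpen_ball
      (fun A _ => (hρdiff A).differentiableOn) (hZne B')
  have hgdiff : DifferentiableOn ℂ g (ball (0 : ℂ) y₀) :=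
    ((hLdiff W.powerset).fun_sub (hLdiff (W.powerset \ Dγ))).fun_sub
      ((hLdiff (W.filter fun v => v ∈ S).powerset).fun_sub
        (hLdiff ((W.filter fun v => v ∈ S).powerset \ Dγ)))
  -- Cauchy estimate at `y`
  have hyabs : ‖(y : ℂ)‖ ≤ y₀ / 4 := by
    rw [Complex.norm_real, Real.norm_eq_abs, abs_of_nonneg hy.1]; exact hy.2
  have hclosed : closedBall (y : ℂ) (y₀ / 2) ⊆ ball (0 : ℂ) y₀ := by
    intro z hz
    rw [mem_closedBall] at hz
    rw [mem_ball_zero_iff]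
    calc ‖z‖ = ‖(z - y) + y‖ := by ring_nf
      _ ≤ ‖z - (y : ℂ)‖ + ‖(y : ℂ)‖ := norm_add_le _ _
      _ ≤ y₀ / 2 + y₀ / 4 := add_le_add (by rwa [← dist_eq_norm]) hyabs
      _ < y₀ := by linarith
  have hderiv : ‖deriv g y‖ ≤ B / (y₀ / 2) := by
    refine Complex.norm_deriv_le_of_forall_mem_sphere_norm_le (by positivity)
      (hgdiff.diffContOnCl_ball hclosed) fun z hz => hgbound z ?_
    have hz' : z ∈ closedBall (y : ℂ) (y₀ / 2) := sphere_subset_closedBall hz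
    exact (le_of_lt (mem_ball_zero_iff.1 (hclosed hz')))
  -- on the real axis `g` is the real four-term log-combination
  have hZ : ∀ (t : ℝ) (S' : Set HexVertex), ((Zloop H S' t : ℝ) : ℂ) =
      polymerPartitionFunction polyInc (ρ t) (W.filter fun v => v ∈ S').powerset :=
    fun t S' => zloop_eq_polymerPartitionFunction hΩ hδ0 S' t
  have hZ1 : ∀ t : ℝ, ((Zloop H Set.univ t : ℝ) : ℂ) = polymerPartitionFunction polyInc (ρ t) W.powerset := by
    intro t
    rw [hZ t, filter_mem_univ_eq W]
  have hZ2 : ∀ t : ℝ, ((Zloop H Sγ t : ℝ) : ℂ) =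
      polymerPartitionFunction polyInc (ρ t) (W.powerset \ Dγ) := by
    intro t
    rw [hDγ, hSγ, hZ t, powerset_filter_notMem_eq W γ.walk.support]
  have hZ3 : ∀ t : ℝ, ((Zloop H S t : ℝ) : ℂ) =
      polymerPartitionFunction polyInc (ρ t) (W.filter fun v => v ∈ S).powerset := fun t => hZ t S
  have hZ4 : ∀ t : ℝ, ((Zloop H (S \ Tγ) t : ℝ) : ℂ) =
      polymerPartitionFunction polyInc (ρ t) ((W.filter fun v => v ∈ S).powerset \ Dγ) := by
    intro t
    rw [hDγ, hTγ, hZ t, powerset_filter_mem_sdiff_walk W S γ.walk.support]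
  have hreal : ∀ t : ℝ, |t| < y₀ →
      g t = (((Real.log (Zloop H Set.univ t) - Real.log (Zloop H Sγ t)) -
        (Real.log (Zloop H S t) - Real.log (Zloop H (S \ Tγ) t)) : ℝ) : ℂ) := by
    intro t ht
    have htn : ‖(t : ℂ)‖ ≤ y₀ := by rw [Complex.norm_real, Real.norm_eq_abs]; exact ht.le
    have him : ∀ A, (ρ t A).im = 0 := by
      intro A
      simp only [hρ]
      rw [Complex.im_sum]
      refine Finset.sum_eq_zero fun E _ => ?_
      rw [← Complex.ofReal_pow, Complex.ofReal_im]
    have hL : ∀ B' : Finset (Finset HexVertex), polymerLogZ polyInc (ρ t) B' =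
        (Real.log (polymerPartitionFunction polyInc (ρ t) B').re : ℂ) := fun B' =>
      (polymerLogZ_eq_log_of_real (inc := polyInc) him fun u hu =>
        (hray t htn u hu).polymerPartitionFunction_ne_zero B').2
    simp only [hg]
    rw [hL, hL, hL, hL, ← hZ1 t, ← hZ2 t, ← hZ3 t, ← hZ4 t]
    simp only [Complex.ofReal_re, Complex.ofReal_sub]
  -- transfer the complex derivative to the real log-combination
  have hHas : HasDerivAt g (deriv g y) y :=
    (hgdiff.differentiableAt (isOpen_ball.mem_nhds (hclosed (mem_closedBall_self (by positivity))))).hasDerivAt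
  have hre := hHas.real_of_complex
  have hG : HasDerivAt (fun t : ℝ => (Real.log (Zloop H Set.univ t) - Real.log (Zloop H Sγ t)) -
      (Real.log (Zloop H S t) - Real.log (Zloop H (S \ Tγ) t))) (deriv g y).re y := by
    refine hre.congr_of_eventuallyEq ?_
    have hnhds : ball y (y₀ / 2) ∈ 𝓝 y := ball_mem_nhds y (by positivity)
    filter_upwards [hnhds] with t ht
    have ht' : |t| < y₀ := by
      rw [mem_ball, Real.dist_eq] at ht
      have hy' : |y| ≤ y₀ / 4 := by rw [abs_of_nonneg hy.1]; exact hy.2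
      calc |t| = |(t - y) + y| := by ring_nf
        _ ≤ |t - y| + |y| := abs_add_le _ _
        _ < y₀ / 2 + y₀ / 4 := add_lt_add_of_lt_of_le ht hy'
        _ ≤ y₀ := by linarith
    rw [hreal t ht', Complex.ofReal_re]
  have hpos : ∀ S' : Set HexVertex, 0 < Zloop H S' y := fun S' =>
    lt_of_lt_of_le one_pos (one_le_zloop hΩ hδ0 hy.1 S')
  have hG' : HasDerivAt (fun t : ℝ => (Real.log (Zloop H Set.univ t) - Real.log (Zloop H Sγ t)) -
      (Real.log (Zloop H S t) - Real.log (Zloop H (S \ Tγ) t)))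
      ((deriv (fun t => Zloop H Set.univ t) y / Zloop H Set.univ y -
          deriv (fun t => Zloop H Sγ t) y / Zloop H Sγ y) -
        (deriv (fun t => Zloop H S t) y / Zloop H S y -
          deriv (fun t => Zloop H (S \ Tγ) t) y / Zloop H (S \ Tγ) y)) y :=
    ((((differentiable_zloop hΩ hδ0 Set.univ) y).hasDerivAt.log (hpos _).ne').fun_sub
      (((differentiable_zloop hΩ hδ0 Sγ) y).hasDerivAt.log (hpos _).ne')).fun_sub
    ((((differentiable_zloop hΩ hδ0 S) y).hasDerivAt.log (hpos _).ne').fun_sub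
      (((differentiable_zloop hΩ hδ0 (S \ Tγ)) y).hasDerivAt.log (hpos _).ne'))
  have heq := hG.unique hG'
  -- conclude
  have hK : B / (y₀ / 2) = 2 / y₀ * B := by
    field_simp
  calc |(deriv (fun t => Zloop H Sγ t) y / Zloop H Sγ y -
          deriv (fun t => Zloop H Set.univ t) y / Zloop H Set.univ y) -
        (deriv (fun t => Zloop H (S \ Tγ) t) y / Zloop H (S \ Tγ) y -
          deriv (fun t => Zloop H S t) y / Zloop H S y)|
      = |(deriv g y).re| := by
        rw [heq, ← abs_neg]
        congr 1
        ring
    _ ≤ ‖deriv g y‖ := Complex.abs_re_le_norm _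
    _ ≤ B / (y₀ / 2) := hderiv
    _ = 2 / y₀ * B := hK
    _ = 2 / y₀ * ∑ v ∈ γ.walk.support.toFinset, ∑ᶠ w ∈ V \ S,
          Real.exp (-((1 / 2) * (hexGraph.dist v w : ℝ))) := by
        rw [hB]
        congr 1
        refine Finset.sum_congr rfl fun v _ => ?_
        rw [finsum_mem_eq_finite_toFinset_sum _ hVfin]

end Summit.CriticalPhenomena.SAWScalingLimit.Theorems.SAWMassiveIsingTilt

end
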